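import Mathlib

/-!
# Crux triage r1 / triager 3 — kernel-checked cores for two costume findings
(crux `VanishingNoiseBound`, stmt-AtomisticToContinuum-11976)

* `superadditive_at_zero_of_uniform` — card A (`fekete-usc-one-length`): an ε-UNIFORM junction
  defect on `(0,1]` plus fixed-length continuity of `ε ↦ R N ε` at `0⁺` (for every length) already
  gives the deterministic superadditivity `R (N+M) 0 ≥ R N 0 + R M 0 - C`, i.e. the open sibling crux
  `JunctionLocality.SuperadditiveResistance` (stmt-AtomisticToContinuum-11748) at `ε = 0`.
* `sqrt_law_of_stieltjes_bound` — card B (`stieltjes-noise-threshold`): if the Stieltjes form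
  `ε ∫ dν(t)/(ε²+t)` is `≤ C` at some rate `ε > 0`, then `ν [0, ε²] ≤ 2 C ε`; hence an ε-uniform
  bound on `(0, ε₁]` FORCES the "√r law at threshold" `ν([0,r]) ≤ 2C√r` for `r ≤ ε₁²` — the card's
  `⟸` is an `⟺` (relocation of the crux, not a weakening).
* `two_channel_sup_bound` — card C (`two-channel-leak-criterion`): the abstract sufficiency step —
  a cost minorant `2εa + b/(8ε)` depending on the level-one part only, plus the level-one
  criterion `t² ≤ C√(ab)`, bound the variational value by `C` uniformly in `ε`.
-/

open MeasureTheory Set Filter Topology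

/-- Card A core: ε-uniform superadditivity-with-defect on `(0,1]` and continuity of each
`ε ↦ R N ε` at `0` from the right give superadditivity-with-the-same-defect at `ε = 0`. -/
theorem superadditive_at_zero_of_uniform (R : ℕ → ℝ → ℝ) (C : ℝ)
    (hsup : ∀ ε : ℝ, 0 < ε → ε ≤ 1 → ∀ N M : ℕ, 2 ≤ N → 2 ≤ M →
      R N ε + R M ε - C ≤ R (N + M) ε)
    (hcont : ∀ N : ℕ, Tendsto (R N) (𝓝[>] 0) (𝓝 (R N 0))) :
    ∀ N M : ℕ, 2 ≤ N → 2 ≤ M → R N 0 + R M 0 - C ≤ R (N + M) 0 := by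
  intro N M hN hM
  have hlim1 : Tendsto (fun ε => R N ε + R M ε - C) (𝓝[>] 0) (𝓝 (R N 0 + R M 0 - C)) :=
    ((hcont N).add (hcont M)).sub_const C
  have hlim2 : Tendsto (fun ε => R (N + M) ε) (𝓝[>] 0) (𝓝 (R (N + M) 0)) := hcont (N + M)
  have hev : ∀ᶠ ε in 𝓝[>] (0 : ℝ), R N ε + R M ε - C ≤ R (N + M) ε := by
    have h1 : ∀ᶠ ε in 𝓝[>] (0 : ℝ), ε ∈ Ioo (0 : ℝ) 1 :=
      Ioo_mem_nhdsGT (by norm_num : (0 : ℝ) < 1)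
    filter_upwards [h1] with ε hε
    exact hsup ε hε.1 hε.2.le N M hN hM
  exact le_of_tendsto_of_tendsto hlim1 hlim2 hev

/-- Card B core (tauberian half): for a finite measure `ν` on `ℝ` carried by `[0, ∞)` and a rate
`ε > 0`, the Stieltjes form dominates the mass near threshold:
`ε ∫ (ε² + t)⁻¹ dν ≥ ν[0, ε²] / (2ε)`. Hence `ε ∫ (ε²+t)⁻¹ dν ≤ C` forces `ν [0, ε²] ≤ 2 C ε`. -/
theorem sqrt_law_of_stieltjes_bound (ν : Measure ℝ) [IsFiniteMeasure ν]
    (hsupp : ν (Iio 0) = 0) {ε C : ℝ} (hε : 0 < ε)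
    (hint : Integrable (fun t => (ε ^ 2 + t)⁻¹) ν)
    (hC : ε * ∫ t, (ε ^ 2 + t)⁻¹ ∂ν ≤ C) :
    (ν (Icc 0 (ε ^ 2))).toReal ≤ 2 * C * ε := by
  have hε2 : 0 < ε ^ 2 := by positivity
  -- the integrand is ≥ 0 ν-a.e. (ν lives on [0, ∞))
  have hae : ∀ᵐ t ∂ν, 0 ≤ t := by
    rw [ae_iff]
    have : {t : ℝ | ¬ 0 ≤ t} = Iio 0 := by ext t; simp
    rw [this]; exact hsupp
  have hnonneg : 0 ≤ᵐ[ν] fun t => (ε ^ 2 + t)⁻¹ := by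
    filter_upwards [hae] with t ht
    positivity
  -- restrict to [0, ε²]: there the integrand is ≥ 1/(2ε²)
  have hset : ∫ t in Icc 0 (ε ^ 2), (ε ^ 2 + t)⁻¹ ∂ν ≤ ∫ t, (ε ^ 2 + t)⁻¹ ∂ν :=
    setIntegral_le_integral hint hnonneg
  have hlow : (ν (Icc 0 (ε ^ 2))).toReal * (2 * ε ^ 2)⁻¹ ≤
      ∫ t in Icc 0 (ε ^ 2), (ε ^ 2 + t)⁻¹ ∂ν := by
    have h1 : ∫ _ in Icc 0 (ε ^ 2), (2 * ε ^ 2)⁻¹ ∂ν =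
        (ν (Icc 0 (ε ^ 2))).toReal * (2 * ε ^ 2)⁻¹ := by
      rw [setIntegral_const, smul_eq_mul, measureReal_def]
    rw [← h1]
    refine setIntegral_mono_on ?_ hint.integrableOn measurableSet_Icc ?_
    · exact (integrable_const _).integrableOn
    · intro t ht
      have ht0 : 0 ≤ t := ht.1
      have ht1 : t ≤ ε ^ 2 := ht.2
      have hpos : 0 < ε ^ 2 + t := by positivity
      rw [inv_le_inv₀ (by positivity) hpos]
      linarith
  have hmain : (ν (Icc 0 (ε ^ 2))).toReal * (2 * ε ^ 2)⁻¹ ≤ C / ε := by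
    have : ∫ t, (ε ^ 2 + t)⁻¹ ∂ν ≤ C / ε := by
      rw [le_div_iff₀ hε]; linarith [hC]
    linarith [hlow, hset, this]
  have h2 : (ν (Icc 0 (ε ^ 2))).toReal ≤ C / ε * (2 * ε ^ 2) := by
    have := mul_le_mul_of_nonneg_right hmain (by positivity : (0 : ℝ) ≤ 2 * ε ^ 2)
    rwa [mul_assoc, inv_mul_cancel₀ (by positivity), mul_one] at this
  calc (ν (Icc 0 (ε ^ 2))).toReal ≤ C / ε * (2 * ε ^ 2) := h2
    _ = 2 * C * ε := by field_simp

/-- Card B, packaged: an ε-UNIFORM Stieltjes bound on `(0, ε₁]` gives the √r law at threshold,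
`ν [0, r] ≤ 2 C √r` for `0 < r ≤ ε₁²`. -/
theorem sqrt_law_of_uniform_stieltjes_bound (ν : Measure ℝ) [IsFiniteMeasure ν]
    (hsupp : ν (Iio 0) = 0) {ε₁ C : ℝ}
    (hint : ∀ ε : ℝ, 0 < ε → Integrable (fun t => (ε ^ 2 + t)⁻¹) ν)
    (hC : ∀ ε : ℝ, 0 < ε → ε ≤ ε₁ → ε * ∫ t, (ε ^ 2 + t)⁻¹ ∂ν ≤ C)
    {r : ℝ} (hr : 0 < r) (hr1 : r ≤ ε₁ ^ 2) (hε₁ : 0 < ε₁) :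
    (ν (Icc 0 r)).toReal ≤ 2 * C * Real.sqrt r := by
  have hs : 0 < Real.sqrt r := Real.sqrt_pos.mpr hr
  have hsq : Real.sqrt r ^ 2 = r := Real.sq_sqrt hr.le
  have hle : Real.sqrt r ≤ ε₁ := by
    rw [← Real.sqrt_sq hε₁.le]
    exact Real.sqrt_le_sqrt hr1
  have h := sqrt_law_of_stieltjes_bound ν hsupp hs (hint _ hs) (hC _ hs hle)
  rwa [hsq] at h

/-- Card C core (the abstract sufficiency step of the two-channel criterion, cf. TRIAGE-r1-1 §3):
if the variational cost of a test function dominates `2ε·a + b/(8ε)` with `a, b ≥ 0` depending on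
its level-one part only, and the level-one criterion `t² ≤ C·√(a·b)` holds for the overlap `t`,
then the variational value `2t - cost` is `≤ C` — uniformly in the rate `ε`. (AM–GM:
`2εa + b/(8ε) ≥ √(ab) ≥ t²/C`, and `2t - t²/C ≤ C`.) -/
theorem two_channel_sup_bound {t a b ε C cost : ℝ} (hε : 0 < ε) (hC : 0 < C) (ha : 0 ≤ a)
    (hb : 0 ≤ b) (hcost : 2 * ε * a + b / (8 * ε) ≤ cost)
    (hcrit : t ^ 2 ≤ C * Real.sqrt (a * b)) : 2 * t - cost ≤ C := by
  have hab : 0 ≤ a * b := mul_nonneg ha hb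
  set s := Real.sqrt (a * b) with hs
  have hs0 : 0 ≤ s := Real.sqrt_nonneg _
  have hss : s ^ 2 = a * b := by rw [hs, Real.sq_sqrt hab]
  have hamgm : s ≤ 2 * ε * a + b / (8 * ε) := by
    -- (√(2εa) - √(b/(8ε)))² ≥ 0  ⇔  2εa + b/(8ε) ≥ 2√(2εa·b/(8ε)) = √(ab)
    have h16 : (2 * ε * a + b / (8 * ε)) ^ 2 - s ^ 2 = (2 * ε * a - b / (8 * ε)) ^ 2 := by
      rw [hss]; field_simp; ring
    have hpos : 0 ≤ 2 * ε * a + b / (8 * ε) := by positivity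
    nlinarith [sq_nonneg (2 * ε * a - b / (8 * ε)), h16, hpos, hs0]
  have ht : t ^ 2 / C ≤ s := by
    rw [div_le_iff₀ hC]; linarith [hcrit, mul_comm C s]
  have key : 2 * t - s ≤ C := by
    have : 2 * t - t ^ 2 / C ≤ C := by
      have h := sq_nonneg (t - C)
      have hC' : C ≠ 0 := hC.ne'
      have : 2 * t - t ^ 2 / C - C = -((t - C) ^ 2) / C := by field_simp; ring
      have hneg : -((t - C) ^ 2) / C ≤ 0 := div_nonpos_of_nonpos_of_nonneg (by linarith) hC.le
      linarith
    linarith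
  linarith
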